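import Summits.ResolutionOfSingularities.ResolutionOfSingularities.Theorems.FrobeniusLadderFRationalResolutionFixedPointBlowupRegular
import Summits.ResolutionOfSingularities.ResolutionOfSingularities.Theorems.FrobeniusLadderFRationalResolutionVeroneseSingularLocus
import Summits.ResolutionOfSingularities.ResolutionOfSingularities.Theorems.FrobeniusLadderFRationalResolutionVeroneseExponentMonoid
import HarnessLib

/-!
# Crux `FrobeniusLadder.FRationalResolution` (stmt-ResolutionOfSingularities-15317), line `redirect`,
# stub `stub_diagonalizableQuotientResolution` — **quotient points of type `1/r(1,…,1)`: ONE BLOW-UP OF THE POINT IS REGULAR**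
# (every `n`, every characteristic — wild `p ∣ r` included —, every residue field; no Galois data)

Specialisation of `…FixedPointBlowupRegular.isRegular_affineBlowup_maximalIdeal_of_parameters` (p840843) to a fixed prime `𝔔`
whose homogeneous regular parameters `x₁,…,x_n` all have the SAME degree `a₀` (of additive order `r`): the weight kernel is
`{m : r ∣ |m|} = ⟨d : |d| = r⟩` (`…VeroneseExponentMonoid.mem_closure_degree_eq_iff`), the toric model is the Veronese cone
`V(n,r) = 𝔸ⁿ/μ_r`, whose vertex blow-up is regular (`veroneseCone_isRegular_affineBlowup`, p807148). Hence:

* `weight_const_eq_zero_iff` — `Σ mᵢ • a₀ = 0 ↔ ord(a₀) ∣ |m|`;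
* ★★★★★ `isRegular_affineBlowup_maximalIdeal_of_sameDegree` — `S` of finite type over a field, graded by a torsion group `A`,
  `𝔔 ⊇ S_a` (`a ≠ 0`) a fixed prime with homogeneous `xᵢ ∈ 𝔔 ∩ S_{a₀}` generating `𝔪_{S_𝔔}`, `n = dim S_𝔔`; then for ANY
  localization `Rq` of `S₀` at `𝔮 = 𝔔 ∩ S₀`, **`Bl_{𝔪_{Rq}}(Spec Rq)` is a regular scheme**.

E.g. `S = K[y₁,…,y_n]` graded by `ℤ/r` with `deg yᵢ = 1` (any field `K`, any `r ≥ 1`), `𝔔 = (y)`: the cyclic quotient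
singularity `𝔸ⁿ_K/μ_r` of type `1/r(1,…,1)` — and all its étale-local forms — is resolved at the origin by one point blow-up.
Honest label: helper theorems toward ONE leaf stub (no stub, crux or summit closed). No definitions, no named facts, no sorry.
[cite: Kato1994, Thm. (3.2)] [cite: Kollar2007, §2.2] [cite: Matsumura1987, Thm. 8.11; §32 p. 256]
-/

noncomputable section

-- single-problem summit: the doubled namespace component is forced
set_option linter.dupNamespace false

open AlgebraicGeometry IsLocalRing
open Literature.AlgebraicGeometry.Resolution

namespace Summit.ResolutionOfSingularities.ResolutionOfSingularities.Theorems.FRationalResolution.FixedPointBlowupRegular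

universe w

variable {k : Type} [Field k] {A : Type w} [DecidableEq A] [AddCommGroup A] {S : Type}
  [CommRing S] [Algebra k S] (𝒮 : A → Submodule k S) [GradedAlgebra 𝒮]

omit [DecidableEq A] in
/-- Constant weights: `Σ mᵢ • a₀ = 0 ↔ ord(a₀) ∣ |m|`. [folklore] -/
theorem weight_const_eq_zero_iff {n : ℕ} (a₀ : A) (m : Fin n →₀ ℕ) :
    Finsupp.weight (fun _ : Fin n => a₀) m = 0 ↔ addOrderOf a₀ ∣ Finsupp.degree m := by
  rw [FixedPointCompletionChart.weight_eq_sum, ← Finset.sum_smul, ← Finsupp.degree_eq_sum,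
    addOrderOf_dvd_iff_nsmul_eq_zero]

/-- ★★★★★ **One point blow-up resolves a quotient point of type `1/r(1,…,1)` locally.** `S` of finite type over a field,
graded by a torsion group `A`; `𝔔` a prime containing every `S_a`, `a ≠ 0`, with homogeneous `xᵢ ∈ 𝔔` (`i < n`) ALL OF THE
SAME DEGREE `a₀`, generating `𝔪_{S_𝔔}`, `n = dim S_𝔔`; `Rq` any localization of `S₀` at `𝔮 = 𝔔 ∩ S₀`. Then
`Bl_{𝔪_{Rq}}(Spec Rq)` is a regular scheme. [cite: Kato1994, Thm. (3.2)] [cite: Kollar2007, §2.2]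
[cite: Matsumura1987, Thm. 8.11; §32 p. 256] -/
theorem isRegular_affineBlowup_maximalIdeal_of_sameDegree [Algebra.FiniteType k S]
    (hA : AddMonoid.IsTorsion A) (𝔔 : Ideal S) [𝔔.IsPrime]
    (hfix : ∀ a : A, a ≠ 0 → ∀ s ∈ 𝒮 a, s ∈ 𝔔)
    {n : ℕ} (x : Fin n → S) (a₀ : A) (hxa : ∀ i, x i ∈ 𝔔 ∧ x i ∈ 𝒮 a₀)
    (hspan : Ideal.span (algebraMap S (Localization.AtPrime 𝔔) '' Set.range x) =
      maximalIdeal (Localization.AtPrime 𝔔))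
    (hn : (n : WithBot ℕ∞) = ringKrullDim (Localization.AtPrime 𝔔))
    (Rq : Type) [CommRing Rq] [Algebra (𝒮 0) Rq]
    [IsLocalization.AtPrime Rq (𝔔.comap (algebraMap (𝒮 0) S))] [IsLocalRing Rq] :
    Scheme.IsRegular (affineBlowup (maximalIdeal Rq)) := by
  have hr : 1 ≤ addOrderOf a₀ := (hA a₀).addOrderOf_pos
  have hGfin : ({d : Fin n →₀ ℕ | Finsupp.degree d = addOrderOf a₀}).Finite :=
    (Finsupp.finite_of_degree_le (addOrderOf a₀)).subset fun d hd => le_of_eq hd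
  have hG0 : (0 : Fin n →₀ ℕ) ∉ {d : Fin n →₀ ℕ | Finsupp.degree d = addOrderOf a₀} := by
    simp only [Set.mem_setOf_eq, map_zero]
    omega
  have hP : ∀ m : Fin n →₀ ℕ, m ∈ AddSubmonoid.closure {d : Fin n →₀ ℕ | Finsupp.degree d = addOrderOf a₀} ↔
      Finsupp.weight (fun _ : Fin n => a₀) m = 0 := fun m => by
    rw [MonomialAlgebraCompletion.mem_closure_degree_eq_iff, weight_const_eq_zero_iff]
  exact isRegular_affineBlowup_maximalIdeal_of_parameters 𝒮 hA 𝔔 hfix x (fun _ => a₀) hxa hspan hn _ hP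
    {d : Fin n →₀ ℕ | Finsupp.degree d = addOrderOf a₀} hGfin hG0 rfl Rq
    (veroneseCone_isRegular_affineBlowup (ResidueField Rq) n (addOrderOf a₀) hr)

end Summit.ResolutionOfSingularities.ResolutionOfSingularities.Theorems.FRationalResolution.FixedPointBlowupRegular

end
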